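import Summits.BirchSwinnertonDyer.Rank1Residual.X2.ResidualLineCharacters
import Literature.NumberTheory.GaloisRepresentations.ImaginaryQuadraticCyclotomicProofs
import Mathlib.NumberTheory.LegendreSymbol.QuadraticChar.Basic
import HarnessLib

/-!
# X3: the character of a rational line whose kernel field is `ℚ(√q*)`, `q` an odd prime — the
# Legendre symbol modulo `q` as the Dirichlet character `φ` acting on `Φ₀` (quadratic
# Kronecker–Weber, prime conductor), for the DISPLAY form of the certificate road
# (cell `bsd-eis`, seat `bsd-eis-x3` gen 3; route K1 `AdditiveBranchIMC` — supports only)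

HONEST FRAMING (cell `bsd-eis`, `run/shared/lean/pub/bsd-eis/README.md` §4): THEOREMS ONLY; nothing
booked. The display form of the residual count (`X3BranchResidualCountOfCharacters.lean`) takes the
character `φ` of the line `Φ₀` as an explicit primitive Dirichlet character with a proof that it acts on
`Φ₀` (`hφ0 : σ • P = φ(χ_m(σ))·P`). bsd-addord's per-pair Hesse-type line certificates
(`KernelDisc.exists_isRationalLine_kernelChar_of_cert`, records `X3ThreeLineDatumRecords*.lean`)
describe the line by its KERNEL FIELD: "`σ` fixes `Φ₀` pointwise iff `σ` fixes `√D`". This file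
supplies `hφ0` when `ℚ(√D) = ℚ(√q*)` for an odd prime `q` (`q* = (−1/q)·q`; `D = q ≡ 1 (mod 4)` on the
even lines of the records, e.g. `450d2`: `φ = χ_5`, `3042f2`: `φ = χ_13`): the character is the
Legendre symbol `(·/q)` read in `𝔽_p`, a PRIMITIVE Dirichlet character modulo `q`, by the Gauss sum
`s = ∑ (a/q) ζ_q^a` (`s² = q*`, `τs = (χ_q(τ)/q)·s` — the tree's `Rat.exists_gaussSum`, Ireland–Rosen
Prop. 6.3.2) and the structure of a `Γ_ℚ`-module of prime order (X2's `PrimeOrderCharacters`).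

* `X3Branch.legendreCharacter_isPrimitive` — `(·/q) : (ℤ/q)ˣ → 𝔽_pˣ` is primitive (`p, q` odd);
* `X3Branch.smul_eq_legendre_of_kernel_sqrt` — if `σ` fixes `Φ₀` pointwise iff it fixes an `s ≠ 0`
  with `τ • s = (χ_q(τ)/q)·s` for all `τ`, then `σ • P = ((χ_q(σ)/q) ∈ 𝔽_p)·P` on `Φ₀`;
* `X3Branch.smul_eq_legendre_of_kernel_sq_eq_primeStar` — the same from ANY `g` with `g² = q*`
  (e.g. `geomSqrt (q* : ℚ)`) in place of the Gauss sum;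
* §3 `X3Branch.smul_eq_quadraticCharacter_of_kernel_sqrt` — the general form for ANY quadratic
  `ℤ`-valued character `χ` mod `N` and a radical `s` with `τ • s = χ(χ_N(τ))·s` (the input a future
  treatment of `ℚ(√2)` via `ζ₈`, of `ℚ(√q)`, `q ≡ 3 (4)`, and of composite `D` plugs into).

What this is NOT: the general squarefree `D` (products, `√−1`, `√±2`) is not treated; `q ≡ 3 (mod 4)`
positive kernel fields `ℚ(√q)` (conductor `4q`) are not treated.

References: [IrelandRosen1990] Ch. 6 Prop. 6.3.2; [GreenbergVatsal2000] §2 p. 28; [Washington1997] Ch. 3.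
-/

set_option autoImplicit false

noncomputable section

open scoped Classical

namespace Summit.BirchSwinnertonDyer.Rank1Residual.Additive

open NumberField IsDedekindDomain Field WeierstrassCurve
  Literature.NumberTheory.GaloisRepresentations Literature.NumberTheory.EllipticCurves
  Literature.NumberTheory.EllipticCurves.Rank1Residual
  Summit.BirchSwinnertonDyer.Rank1Residual.X2.ResidualDevissageModules
  Summit.BirchSwinnertonDyer.Rank1Residual.X2.ResidualDevissageLine
  Summit.BirchSwinnertonDyer.Rank1Residual.X2.PrimeOrderCharacters
  Summit.BirchSwinnertonDyer.Rank1Residual.X2.ResidualLineCharacters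

variable {W : WeierstrassCurve ℚ} {p : ℕ} [hp : Fact p.Prime]
  {Φ₀ : AddSubgroup (geomTorsion W (p : ℤ))} (hΦ : IsRationalLine W p Φ₀)
  {q : ℕ} [hq : Fact q.Prime]

/-! ### §1 The Legendre symbol modulo `q` as a primitive Dirichlet character with values in `𝔽_p` -/

/-- **`(·/q)` read in `𝔽_p` is a PRIMITIVE Dirichlet character modulo the odd prime `q`** (`p ≠ 2`):
it is non-trivial (some `a` has `(a/q) = −1 ≠ 1` in `𝔽_p`) and its conductor divides the prime `q`.
[cite: Washington1997, Ch. 3 (conductors of Dirichlet characters)] -/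
theorem X3Branch.legendreCharacter_isPrimitive (hp2 : p ≠ 2) (hq2 : q ≠ 2) :
    DirichletCharacter.IsPrimitive
      ((quadraticChar (ZMod q)).ringHomComp (Int.castRingHom (ZMod p)) :
        DirichletCharacter (ZMod p) q) := by
  have hpq : p.Prime := hp.out
  set φ : DirichletCharacter (ZMod p) q := (quadraticChar (ZMod q)).ringHomComp (Int.castRingHom (ZMod p))
    with hφ
  have hne : φ ≠ 1 := by
    intro h1
    have hqchar : ringChar (ZMod q) ≠ 2 := by rwa [ZMod.ringChar_zmod_n]
    obtain ⟨a, ha⟩ := quadraticChar_exists_neg_one hqchar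
    have ha0 : a ≠ 0 := by
      intro h0; rw [h0, quadraticChar_zero] at ha; exact absurd ha (by decide)
    have hu : IsUnit a := isUnit_iff_ne_zero.mpr ha0
    have h2 := congrArg (fun χ : DirichletCharacter (ZMod p) q ↦ χ a) h1
    simp only [hφ, MulChar.ringHomComp_apply, ha, MulChar.one_apply hu, Int.reduceNeg, map_neg,
      map_one] at h2
    have h3 : (2 : ZMod p) = 0 := by linear_combination -h2
    have h3' : ((2 : ℕ) : ZMod p) = 0 := by exact_mod_cast h3
    rw [ZMod.natCast_eq_zero_iff] at h3'
    exact hp2 ((Nat.prime_dvd_prime_iff_eq hpq Nat.prime_two).mp h3')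
  rw [DirichletCharacter.isPrimitive_def]
  have hdvd := DirichletCharacter.conductor_dvd_level φ
  rcases (Nat.dvd_prime hq.out).mp hdvd with h | h
  · exact absurd (DirichletCharacter.eq_one_iff_conductor_eq_one.mpr h) hne
  · exact h

/-! ### §2 The action on `Φ₀` from the kernel field `ℚ(√q*)` -/

include hΦ in
/-- **Quadratic Kronecker–Weber for a line with kernel field `ℚ(s)`, `s` the quadratic Gauss sum**:
if `σ ∈ Γ_ℚ` fixes the rational line `Φ₀ ≤ W[p]` pointwise exactly when it fixes `s ≠ 0`, where
`τ • s = (χ_q(τ)/q)·s` for all `τ`, then every `σ` acts on `Φ₀` as the scalar `(χ_q(σ)/q) ∈ 𝔽_p` (any `p`),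
i.e. `Φ₀` has the character `φ = (·/q) ∘ χ_q` (the Legendre symbol read in `𝔽_p`). Proof: the action
on `Φ₀` is by a character `χ` with `χ(σ) = 1` iff `σ` fixes `s`; `σ²` fixes `s`, so `χ(σ) = ±1`, and
`(χ_q(σ)/q) = ±1` with the same sign condition. [cite: IrelandRosen1990, Ch. 6 Prop. 6.3.2]
[cite: GreenbergVatsal2000, §2 p. 28 (the character φ of Φ)] -/
theorem X3Branch.smul_eq_legendre_of_kernel_sqrt {s : AlgebraicClosure ℚ} (hs0 : s ≠ 0)
    (hs : ∀ τ : absoluteGaloisGroup ℚ,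
      τ • s = ((quadraticChar (ZMod q) (modNCyclotomicCharacter ℚ q τ : ZMod q) : ℤ) :
        AlgebraicClosure ℚ) * s)
    (hker : ∀ σ : absoluteGaloisGroup ℚ, (∀ Q ∈ Φ₀, σ • Q = Q) ↔ σ • s = s)
    (σ : absoluteGaloisGroup ℚ) (P : geomTorsion W (p : ℤ)) (hP : P ∈ Φ₀) :
    σ • P = (((quadraticChar (ZMod q)).ringHomComp (Int.castRingHom (ZMod p)) :
        DirichletCharacter (ZMod p) q) ((modNCyclotomicCharacter ℚ q σ : (ZMod q)ˣ) : ZMod q)).val • P := by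
  have hpr : p.Prime := hp.out
  -- the character of `Φ₀` on the transported line
  obtain ⟨χ, hχ⟩ := exists_character_of_natCard_eq (G := absoluteGaloisGroup ℚ) (natCard_sub_eq hΦ)
  set ε : ℤ := quadraticChar (ZMod q) (modNCyclotomicCharacter ℚ q σ : ZMod q) with hε
  have hεu : (modNCyclotomicCharacter ℚ q σ : ZMod q) ≠ 0 := (modNCyclotomicCharacter ℚ q σ).ne_zero
  -- `χ σ = ε` in `𝔽_p`
  have key : (χ σ : ZMod p) = (ε : ZMod p) := by
    rcases quadraticChar_dichotomy hεu with h1 | h1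
    · -- `σ` fixes `s`, hence `Φ₀`
      have hfix : σ • s = s := by rw [hs σ, h1, Int.cast_one, one_mul]
      have hall : ∀ Q ∈ Φ₀, σ • Q = Q := (hker σ).mpr hfix
      have h := character_eq_one_of_forall_smul_eq (natCard_sub_eq hΦ) hχ
        (fun x ↦ smul_sub_eq_self_of_forall_mem hΦ hall x)
      rw [h, hε, h1, Units.val_one, Int.cast_one]
    · -- `σ s = −s ≠ s`: `σ` does not fix `Φ₀`, but `σ²` does; so `χ σ = −1`
      have hneg : σ • s = -s := by rw [hs σ, h1, Int.cast_neg, Int.cast_one, neg_one_mul]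
      have hnfix : ¬ σ • s = s := by
        rw [hneg, neg_eq_iff_add_eq_zero, ← two_mul, mul_eq_zero, not_or]
        exact ⟨two_ne_zero, hs0⟩
      have hsq : (σ * σ) • s = s := by rw [mul_smul, hneg, smul_neg, hneg, neg_neg]
      have hall2 : ∀ Q ∈ Φ₀, (σ * σ) • Q = Q := (hker (σ * σ)).mpr hsq
      have h2 : χ (σ * σ) = 1 := character_eq_one_of_forall_smul_eq (natCard_sub_eq hΦ) hχ
        (fun x ↦ smul_sub_eq_self_of_forall_mem hΦ hall2 x)
      rw [map_mul] at h2
      have hχ1 : χ σ ≠ 1 := by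
        intro h1'
        apply hnfix
        refine (hker σ).mp fun Q hQ ↦ ?_
        have := smul_eq_nsmul_of_sub hΦ (σ := σ) (n := 1) (fun x ↦ by
          rw [hχ σ x, h1', Units.val_one, ZMod.val_one'' hpr.ne_one]) hQ
        rwa [one_nsmul] at this
      have hsq' : (χ σ : ZMod p) * (χ σ : ZMod p) = 1 := by
        rw [← Units.val_mul, h2, Units.val_one]
      rcases mul_self_eq_one_iff.mp hsq' with h3 | h3
      · exact absurd (Units.ext h3) hχ1
      · rw [h3, hε, h1, Int.cast_neg, Int.cast_one]
  -- read the action on the point `P ∈ Φ₀`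
  have hact := smul_eq_nsmul_of_sub hΦ (σ := σ) (n := (χ σ : ZMod p).val) (fun x ↦ hχ σ x) hP
  rw [hact, MulChar.ringHomComp_apply, eq_intCast, ← key]

include hΦ in
/-- **The same with ANY square root of `q*`** in place of the Gauss sum (e.g. the `geomSqrt (q* : ℚ)` of
the kernel-field certificates): for `q` an odd prime, `q* = (−1/q)·q`, if `σ` fixes `Φ₀` pointwise iff
it fixes some `g` with `g² = q*`, then `Φ₀` has the character `(·/q) ∘ χ_q` in `𝔽_p` (`g = ±s` for the
Gauss sum `s` of `Rat.exists_gaussSum`, and `σg = g ⟺ σs = s`). [cite: IrelandRosen1990, Ch. 6 Prop. 6.3.2]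
[cite: GreenbergVatsal2000, §2 p. 28 (the character φ of Φ)] -/
theorem X3Branch.smul_eq_legendre_of_kernel_sq_eq_primeStar (hq2 : q ≠ 2)
    {g : AlgebraicClosure ℚ}
    (hg : g ^ 2 = ((quadraticChar (ZMod q) (-1) : ℤ) : AlgebraicClosure ℚ) * q)
    (hker : ∀ σ : absoluteGaloisGroup ℚ, (∀ Q ∈ Φ₀, σ • Q = Q) ↔ σ • g = g)
    (σ : absoluteGaloisGroup ℚ) (P : geomTorsion W (p : ℤ)) (hP : P ∈ Φ₀) :
    σ • P = (((quadraticChar (ZMod q)).ringHomComp (Int.castRingHom (ZMod p)) :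
        DirichletCharacter (ZMod p) q) ((modNCyclotomicCharacter ℚ q σ : (ZMod q)ˣ) : ZMod q)).val • P := by
  haveI : NeZero (q : ℚ) := ⟨by exact_mod_cast hq.out.ne_zero⟩
  obtain ⟨s, hs0, hs2, hs⟩ := Rat.exists_gaussSum (p := q) hq2
  -- `g = ±s`
  have hgs : g = s ∨ g = -s := by
    have h : (g - s) * (g + s) = 0 := by
      have : g ^ 2 = s ^ 2 := by rw [hg, hs2]
      linear_combination this
    rcases mul_eq_zero.mp h with h1 | h1
    · exact Or.inl (by linear_combination h1)
    · exact Or.inr (by linear_combination h1)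
  have hker' : ∀ σ : absoluteGaloisGroup ℚ, (∀ Q ∈ Φ₀, σ • Q = Q) ↔ σ • s = s := by
    intro τ
    rw [hker τ]
    rcases hgs with rfl | rfl
    · exact Iff.rfl
    · rw [smul_neg, neg_inj]
  exact X3Branch.smul_eq_legendre_of_kernel_sqrt hΦ hs0 hs hker' σ P hP

/-! ### §3 The same for ANY quadratic kernel character (general kernel discriminant) -/

include hΦ in
/-- **Quadratic Kronecker–Weber for a line, general form.** Let `χ` be a quadratic character modulo
`N` with values in `ℤ` (e.g. `ZMod.χ₈` for `ℚ(√2)`, `(·/q)` for `ℚ(√q*)`, their products for a general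
squarefree kernel discriminant) and `s ≠ 0` an element of `ℚ̄` on which `Γ_ℚ` acts by
`τ • s = χ(χ_N(τ))·s` (e.g. `√2 = ζ₈ + ζ₈⁻¹`, the Gauss sums). If `σ` fixes the rational line
`Φ₀ ≤ W[p]` pointwise exactly when it fixes `s`, then `Γ_ℚ` acts on `Φ₀` through the character
`χ ∘ χ_N` read in `𝔽_p`. The proof of `X3Branch.smul_eq_legendre_of_kernel_sqrt` verbatim (it uses
only `χ(unit) = ±1`). [cite: GreenbergVatsal2000, §2 p. 28 (the character φ of Φ)]
[cite: Washington1997, Ch. 3 (Dirichlet characters as Galois characters)] -/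
theorem X3Branch.smul_eq_quadraticCharacter_of_kernel_sqrt {N : ℕ} [NeZero N]
    (χ : MulChar (ZMod N) ℤ) (hχ2 : χ.IsQuadratic) {s : AlgebraicClosure ℚ} (hs0 : s ≠ 0)
    (hs : ∀ τ : absoluteGaloisGroup ℚ,
      τ • s = ((χ (modNCyclotomicCharacter ℚ N τ : ZMod N) : ℤ) : AlgebraicClosure ℚ) * s)
    (hker : ∀ σ : absoluteGaloisGroup ℚ, (∀ Q ∈ Φ₀, σ • Q = Q) ↔ σ • s = s)
    (σ : absoluteGaloisGroup ℚ) (P : geomTorsion W (p : ℤ)) (hP : P ∈ Φ₀) :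
    σ • P = ((χ.ringHomComp (Int.castRingHom (ZMod p)) : DirichletCharacter (ZMod p) N)
        ((modNCyclotomicCharacter ℚ N σ : (ZMod N)ˣ) : ZMod N)).val • P := by
  have hpr : p.Prime := hp.out
  obtain ⟨χΦ, hχΦ⟩ := exists_character_of_natCard_eq (G := absoluteGaloisGroup ℚ) (natCard_sub_eq hΦ)
  set ε : ℤ := χ (modNCyclotomicCharacter ℚ N σ : ZMod N) with hε
  have hεu : χ (modNCyclotomicCharacter ℚ N σ : ZMod N) ≠ 0 := by
    have hu := IsUnit.map χ (modNCyclotomicCharacter ℚ N σ).isUnit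
    intro h0; rw [h0] at hu; exact not_isUnit_zero hu
  have key : (χΦ σ : ZMod p) = (ε : ZMod p) := by
    rcases hχ2 (modNCyclotomicCharacter ℚ N σ : ZMod N) with h0 | h1 | h1
    · exact absurd h0 hεu
    · have hfix : σ • s = s := by rw [hs σ, h1, Int.cast_one, one_mul]
      have hall : ∀ Q ∈ Φ₀, σ • Q = Q := (hker σ).mpr hfix
      have h := character_eq_one_of_forall_smul_eq (natCard_sub_eq hΦ) hχΦ
        (fun x ↦ smul_sub_eq_self_of_forall_mem hΦ hall x)
      rw [h, hε, h1, Units.val_one, Int.cast_one]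
    · have hneg : σ • s = -s := by rw [hs σ, h1, Int.cast_neg, Int.cast_one, neg_one_mul]
      have hnfix : ¬ σ • s = s := by
        rw [hneg, neg_eq_iff_add_eq_zero, ← two_mul, mul_eq_zero, not_or]
        exact ⟨two_ne_zero, hs0⟩
      have hsq : (σ * σ) • s = s := by rw [mul_smul, hneg, smul_neg, hneg, neg_neg]
      have hall2 : ∀ Q ∈ Φ₀, (σ * σ) • Q = Q := (hker (σ * σ)).mpr hsq
      have h2 : χΦ (σ * σ) = 1 := character_eq_one_of_forall_smul_eq (natCard_sub_eq hΦ) hχΦ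
        (fun x ↦ smul_sub_eq_self_of_forall_mem hΦ hall2 x)
      rw [map_mul] at h2
      have hχ1 : χΦ σ ≠ 1 := by
        intro h1'
        apply hnfix
        refine (hker σ).mp fun Q hQ ↦ ?_
        have := smul_eq_nsmul_of_sub hΦ (σ := σ) (n := 1) (fun x ↦ by
          rw [hχΦ σ x, h1', Units.val_one, ZMod.val_one'' hpr.ne_one]) hQ
        rwa [one_nsmul] at this
      have hsq' : (χΦ σ : ZMod p) * (χΦ σ : ZMod p) = 1 := by
        rw [← Units.val_mul, h2, Units.val_one]
      rcases mul_self_eq_one_iff.mp hsq' with h3 | h3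
      · exact absurd (Units.ext h3) hχ1
      · rw [h3, hε, h1, Int.cast_neg, Int.cast_one]
  have hact := smul_eq_nsmul_of_sub hΦ (σ := σ) (n := (χΦ σ : ZMod p).val) (fun x ↦ hχΦ σ x) hP
  rw [hact, MulChar.ringHomComp_apply, eq_intCast, ← key]

end Summit.BirchSwinnertonDyer.Rank1Residual.Additive

end
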